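import Mathlib
import Literature.Combinatorics.Optimization.ZeroOnePolytopesHighPsdRank
import HarnessLib

/-!
# Matroid polytopes with exponential extension complexity (Rothvoß 2013, Corollary 5)

Source: T. Rothvoß, *Some 0/1 polytopes need exponential size extended formulations*, Math.
Program. 142 (2013) 255–268 = arXiv:1105.0036 [Rothvoss2013]; held text `paper:arxiv-1105.0036`,
§5 (p08, verbatim): "Recall that a pair `([n], 𝓘)` is called a matroid with ground set
`[n] = {1,…,n}` and independent sets `𝓘 ⊆ 2^{[n]}`, if (I) `I ∈ 𝓘, J ⊆ I ⇒ J ∈ 𝓘` and (II) for all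
`I, J ∈ 𝓘` with `|I| < |J|` there is a `z ∈ J \ I` with `I + z ∈ 𝓘`. … Nevertheless, it is well
known that the number of matroids with ground set `{1,…,n}` is at least
`2^{C(n,⌊n/2⌋)/(2n)} ≥ 2^{2ⁿ/(10 n^{3/2})}` for `n` large enough [Dukes 2003]. In other words, there
are doubly-exponentially many matroids. Using the same proof as for Theorem 4 we obtain:
**Corollary 5.** There exists a family `M_n = ({1,…,n}, 𝓘_n)` of matroids such that
`xc(conv(χ(𝓘_n))) = Ω(2^{n/2} / (n^{5/4} log(2n)))`."  (`χ(𝓘)` = the characteristic vectors of the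
independent sets; `xc` = least size of an extended formulation, §3 p05, = least size of a
slack-form EF, the tree's `Literature.Barriers.PneNP.HasEFOfSize`.)

What this file PROVES (namespace `Literature.Combinatorics.Optimization`, helpers in
`SparsePavingXC`; matroids are Mathlib's `Matroid (Fin n)`):
* `SparsePavingXC.codeClass`, `codeClass_far`, `exists_large_codeClass` — the standard
  doubly-exponential family behind "it is well known": the `k`-subsets of `[n]` with a fixed residue
  of their element sum mod `n` form a constant-weight code of minimum distance `≥ 4` (no two members
  differ by a single exchange), and some residue class `𝒰` has `n·|𝒰| ≥ C(n,k)` (Graham–Sloane /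
  Knuth's construction; the printed count cites [Dukes 2003]);
* `SparsePavingXC.spMatroid` — for every `𝒮 ⊆ 𝒰` the **sparse paving matroid** whose independent
  sets are the sets of size `< k` and the `k`-sets not in `𝒮` (axioms (I), (II) verified through
  `IndepMatroid.ofFinset`), with `spMatroid_indep_iff`; distinct `𝒮` give distinct vertex sets
  `χ(𝓘)` (`vertexSet_injOn`), so there are `2^{|𝒰|} ≥ 2^{C(n,k)/n}` matroid polytopes;
* `SparsePavingXC.choose_le_of_forall_hasEFOfSize` — the count, from the tree's coding theorem for
  0/1 polytopes `ZeroOneLpEF.card_le_of_forall_hasEFOfSize` (Rothvoß's Thm. 3/4: a family of vertex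
  sets all with EFs of size `r`, `n ≤ r ≤ 2ⁿ`, has `≤ 2^{96 n r²}` members): if all these matroid
  polytopes have EFs of size `r` then `C(n, ⌊n/2⌋) ≤ 96 n² r²`;
* `SparsePavingXC.exists_matroid_choose_le` — hence for `n ≥ 33` a sparse paving matroid on `[n]`
  all of whose EFs have size `k` with `C(n,⌊n/2⌋) ≤ 96 n² k²`;
* `Rothvoss2013_cor5` — the printed Corollary 5 (`Ω` as `∃ c > 0 ∃ n₀ ∀ n ≥ n₀`; `c = 1/17`,
  `n₀ = 33`), using `C(n,⌊n/2⌋) ≥ 2ⁿ/√(8n)` (`sixteen_pow_le`);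
* `SparsePavingXC.exists_injOn_matroid_family` — "doubly-exponentially many matroids": an
  injection of the `2^{|𝒰|}` subfamilies, `n·|𝒰| ≥ C(n,⌊n/2⌋)`, into `Matroid (Fin n)`.

Proof = the printed one ("the same proof as for Theorem 4" = the tree's `ZeroOneLpEF` coding, plus
the matroid count), with the recorded DEVIATIONS: (1) the family of matroids is the explicit sparse
paving family above (`≥ 2^{C(n,⌊n/2⌋)/n}` members) rather than an appeal to [Dukes 2003]; (2) as in
`ZeroOnePolytopesHighPsdRank.lean`, the coding uses `±1` separators, so no logarithm is lost and the
bound obtained, `k ≥ 2^{n/2}/(17 n^{5/4})`, implies the printed one since `log(2n) ≥ 1`.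
-/

noncomputable section

open Finset

namespace Literature.Combinatorics.Optimization

namespace SparsePavingXC

open Literature.Barriers.PneNP

variable {n : ℕ}

/-! ### M1. A constant-weight code of distance `≥ 4`: `k`-sets with a fixed element-sum residue -/

/-- The element sum `Σ_{i ∈ S} i ∈ ℕ` of a set `S ⊆ [n]`. [cite: Rothvoss2013, §5 (p08, "it is well known that the number of matroids … is at least `2^{C(n,⌊n/2⌋)/(2n)}`")] -/
def wsum (S : Finset (Fin n)) : ℕ := ∑ i ∈ S, (i : ℕ)

/-- The `k`-subsets of `[n]` whose element sum is `≡ a (mod n)`. [cite: Rothvoss2013, §5 (p08)] -/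
def codeClass (n k a : ℕ) : Finset (Finset (Fin n)) :=
  (univ.powersetCard k).filter fun S => wsum S % n = a

/-- Membership in a residue class. [cite: Rothvoss2013, §5 (p08)] -/
theorem mem_codeClass {k a : ℕ} {S : Finset (Fin n)} :
    S ∈ codeClass n k a ↔ S.card = k ∧ wsum S % n = a := by
  simp [codeClass, mem_powersetCard]

/-- The element sum splits along `S = (S \ T) ∪ (S ∩ T)`. [folklore] -/
private theorem wsum_eq_sdiff_add_inter (S T : Finset (Fin n)) :
    wsum S = wsum (S \ T) + wsum (S ∩ T) := by
  unfold wsum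
  rw [← Finset.sum_union (disjoint_sdiff_inter S T), sdiff_union_inter]

/-- **Minimum distance `≥ 4`.** Two members of one residue class never differ by a single exchange:
if `S \ T = {i}` then `T \ S = {j}` and `i ≡ j (mod n)`, so `i = j`. [cite: Rothvoss2013, §5 (p08)] -/
theorem codeClass_far {k a : ℕ} {S T : Finset (Fin n)} (hS : S ∈ codeClass n k a)
    (hT : T ∈ codeClass n k a) (h1 : (S \ T).card = 1) : False := by
  rw [mem_codeClass] at hS hT
  have hcardT : (T \ S).card = 1 := by
    have h₁ := card_sdiff_add_card_inter S T
    have h₂ := card_sdiff_add_card_inter T S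
    rw [inter_comm T S] at h₂
    omega
  obtain ⟨i, hi⟩ := card_eq_one.1 h1
  obtain ⟨j, hj⟩ := card_eq_one.1 hcardT
  have hiS : i ∈ S \ T := by rw [hi]; exact mem_singleton_self i
  have hjT : j ∈ T \ S := by rw [hj]; exact mem_singleton_self j
  have hsumS : wsum S = (i : ℕ) + wsum (S ∩ T) := by
    rw [wsum_eq_sdiff_add_inter S T, hi]; simp [wsum]
  have hsumT : wsum T = (j : ℕ) + wsum (S ∩ T) := by
    rw [wsum_eq_sdiff_add_inter T S, hj, inter_comm T S]; simp [wsum]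
  have hmod : ((i : ℕ) + wsum (S ∩ T)) % n = ((j : ℕ) + wsum (S ∩ T)) % n := by
    rw [← hsumS, ← hsumT, hS.2, hT.2]
  have hij : (i : ℕ) % n = (j : ℕ) % n := Nat.ModEq.add_right_cancel' _ hmod
  rw [Nat.mod_eq_of_lt i.2, Nat.mod_eq_of_lt j.2] at hij
  have : i = j := Fin.ext hij
  rw [this] at hiS
  exact (mem_sdiff.1 hjT).2 (mem_sdiff.1 hiS).1

/-- **A large class**: some residue class contains at least a `1/n` fraction of the `k`-sets,
`C(n, k) ≤ n · |𝒰|`. [cite: Rothvoss2013, §5 (p08)] -/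
theorem exists_large_codeClass (hn : 1 ≤ n) (k : ℕ) :
    ∃ a, n.choose k ≤ n * (codeClass n k a).card := by
  classical
  have hmaps : ∀ S ∈ (univ : Finset (Fin n)).powersetCard k, wsum S % n ∈ range n := fun S _ =>
    mem_range.2 (Nat.mod_lt _ (by omega))
  obtain ⟨a, -, ha⟩ := exists_max_image (range n) (fun a => (codeClass n k a).card)
    ⟨0, mem_range.2 (by omega)⟩
  refine ⟨a, ?_⟩
  calc n.choose k = ((univ : Finset (Fin n)).powersetCard k).card := by
        rw [card_powersetCard, card_univ, Fintype.card_fin]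
    _ = ∑ b ∈ range n, (codeClass n k b).card := card_eq_sum_card_fiberwise hmaps
    _ ≤ ∑ _b ∈ range n, (codeClass n k a).card := sum_le_sum fun b hb => ha b hb
    _ = n * (codeClass n k a).card := by rw [sum_const, card_range, smul_eq_mul]

/-! ### M2. Sparse paving matroids -/

/-- The independence predicate of the sparse paving matroid attached to a family `𝒮` of `k`-sets:
the sets of size `< k`, and the `k`-sets NOT in `𝒮` (the bases are the `k`-sets outside `𝒮`).
[cite: Rothvoss2013, §5 (p08, axioms (I)–(II))] -/
def SPIndep (k : ℕ) (𝒮 : Finset (Finset (Fin n))) (I : Finset (Fin n)) : Prop :=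
  I.card < k ∨ (I.card = k ∧ I ∉ 𝒮)

variable {k a : ℕ} {𝒮 : Finset (Finset (Fin n))}

/-- Axiom (I): subsets of independent sets are independent. [cite: Rothvoss2013, §5 (p08, (I))] -/
theorem spIndep_subset {I J : Finset (Fin n)} (hJ : SPIndep k 𝒮 J) (hIJ : I ⊆ J) :
    SPIndep k 𝒮 I := by
  have hc := card_le_card hIJ
  rcases hJ with hJ | ⟨hJk, hJ𝒮⟩
  · exact Or.inl (lt_of_le_of_lt hc hJ)
  · rcases lt_or_eq_of_le hc with hlt | heq
    · exact Or.inl (hJk ▸ hlt)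
    · have : I = J := eq_of_subset_of_card_le hIJ heq.ge
      exact Or.inr ⟨by rw [this, hJk], by rwa [this]⟩

/-- Axiom (II), the exchange property, for `𝒮` inside one residue class: if `|I| < |J|` are
independent, some `e ∈ J \ I` keeps `I + e` independent — when `|I| = k − 1` and `|J \ I| ≥ 2`, two
candidates `I + e₁`, `I + e₂` differ by a single exchange, so at most one of them lies in `𝒮`.
[cite: Rothvoss2013, §5 (p08, (II))] -/
theorem spIndep_aug (h𝒮 : 𝒮 ⊆ codeClass n k a) {I J : Finset (Fin n)}
    (hJ : SPIndep k 𝒮 J) (hlt : I.card < J.card) :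
    ∃ e ∈ J, e ∉ I ∧ SPIndep k 𝒮 (insert e I) := by
  classical
  have hJk : J.card ≤ k := by
    rcases hJ with h | ⟨h, -⟩
    · exact h.le
    · exact h.le
  have hIk : I.card < k := lt_of_lt_of_le hlt hJk
  -- `J \ I` is nonempty
  have hne : (J \ I).Nonempty := by
    rw [nonempty_iff_ne_empty]
    intro h0
    have : J ⊆ I := by
      intro x hx
      by_contra hxI
      have : x ∈ J \ I := mem_sdiff.2 ⟨hx, hxI⟩
      rw [h0] at this
      exact notMem_empty _ this
    exact absurd (card_le_card this) (not_le.2 hlt)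
  by_cases hsmall : I.card + 1 < k
  · obtain ⟨e, he⟩ := hne
    refine ⟨e, (mem_sdiff.1 he).1, (mem_sdiff.1 he).2, Or.inl ?_⟩
    rw [card_insert_of_notMem (mem_sdiff.1 he).2]; exact hsmall
  · -- `|I| = k - 1`, so `|J| = k` and `J ∉ 𝒮`
    have hIk1 : I.card + 1 = k := by omega
    have hJk' : J.card = k := by omega
    by_cases hone : (J \ I).card = 1
    · -- `J = I + e`
      obtain ⟨e, he⟩ := card_eq_one.1 hone
      have heJI : e ∈ J \ I := by rw [he]; exact mem_singleton_self e
      refine ⟨e, (mem_sdiff.1 heJI).1, (mem_sdiff.1 heJI).2, ?_⟩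
      -- `I ⊆ J`: `|J ∩ I| = |J| - 1 = |I|`
      have hIJ : I ⊆ J := by
        have h₁ := card_sdiff_add_card_inter J I
        have hc : (J ∩ I).card = I.card := by omega
        have : J ∩ I = I := eq_of_subset_of_card_le inter_subset_right hc.ge
        exact this ▸ inter_subset_left
      have heq : insert e I = J := by
        apply eq_of_subset_of_card_le
        · exact insert_subset (mem_sdiff.1 heJI).1 hIJ
        · rw [card_insert_of_notMem (mem_sdiff.1 heJI).2]; omega
      rw [heq]; exact hJ
    · -- two candidates
      have htwo : 1 < (J \ I).card := by
        have := hne.card_pos; omega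
      obtain ⟨e₁, he₁, e₂, he₂, hne12⟩ := one_lt_card.1 htwo
      have hc₁ : (insert e₁ I).card = k := by rw [card_insert_of_notMem (mem_sdiff.1 he₁).2]; omega
      have hc₂ : (insert e₂ I).card = k := by rw [card_insert_of_notMem (mem_sdiff.1 he₂).2]; omega
      by_cases h₁ : insert e₁ I ∈ 𝒮
      · by_cases h₂ : insert e₂ I ∈ 𝒮
        · exfalso
          refine codeClass_far (h𝒮 h₁) (h𝒮 h₂) ?_
          have : insert e₁ I \ insert e₂ I = {e₁} := by
            ext x
            simp only [mem_sdiff, mem_insert, mem_singleton]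
            constructor
            · rintro ⟨h | h, h'⟩
              · exact h
              · exact absurd (Or.inr h) h'
            · rintro rfl
              exact ⟨Or.inl rfl, fun h => h.elim hne12 (mem_sdiff.1 he₁).2⟩
          rw [this, card_singleton]
        · exact ⟨e₂, (mem_sdiff.1 he₂).1, (mem_sdiff.1 he₂).2, Or.inr ⟨hc₂, h₂⟩⟩
      · exact ⟨e₁, (mem_sdiff.1 he₁).1, (mem_sdiff.1 he₁).2, Or.inr ⟨hc₁, h₁⟩⟩

/-- **The sparse paving matroid** on `[n]` attached to `𝒮 ⊆ 𝒰` (a subfamily of one residue class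
of `k`-sets, `k ≥ 1`), as a Mathlib `Matroid`. [cite: Rothvoss2013, §5 (p08)] -/
def spMatroid (hk : 1 ≤ k) (h𝒮 : 𝒮 ⊆ codeClass n k a) : Matroid (Fin n) :=
  (IndepMatroid.ofFinset (Set.univ : Set (Fin n)) (SPIndep k 𝒮)
    (Or.inl (by rw [card_empty]; omega))
    (fun _ _ hJ hIJ => spIndep_subset hJ hIJ)
    (fun _ _ _ hJ hlt => spIndep_aug h𝒮 hJ hlt)
    (fun _ _ => Set.subset_univ _)).matroid

/-- Independence in the sparse paving matroid. [cite: Rothvoss2013, §5 (p08)] -/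
theorem spMatroid_indep_iff (hk : 1 ≤ k) (h𝒮 : 𝒮 ⊆ codeClass n k a) {I : Finset (Fin n)} :
    (spMatroid hk h𝒮).Indep (I : Set (Fin n)) ↔ SPIndep k 𝒮 I := by
  rw [spMatroid, IndepMatroid.matroid_indep_iff, IndepMatroid.ofFinset_indep]

/-! ### M3. The vertex sets `χ(𝓘)` -/

/-- The support of a 0/1 vector. [folklore] -/
def support (z : Fin n → Bool) : Finset (Fin n) := univ.filter fun i => z i = true

/-- The indicator vector of a set. [folklore] -/
def indicator (S : Finset (Fin n)) : Fin n → Bool := fun i => decide (i ∈ S)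

/-- `support (indicator S) = S`. [folklore] -/
private theorem support_indicator (S : Finset (Fin n)) : support (indicator S) = S := by
  ext i; simp [support, indicator]

/-- The vertex set `χ(𝓘(𝒮)) ⊆ {0,1}ⁿ` of the matroid polytope. [cite: Rothvoss2013, §5 (p08, "`χ(𝓘)` denotes the set of characteristic vectors of `𝓘`")] -/
def vertexSet (k : ℕ) (𝒮 : Finset (Finset (Fin n))) : Finset (Fin n → Bool) :=
  @Finset.filter _ (fun z => SPIndep k 𝒮 (support z)) (Classical.decPred _) univ

/-- Membership in the vertex set. [cite: Rothvoss2013, §5 (p08)] -/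
theorem mem_vertexSet {z : Fin n → Bool} : z ∈ vertexSet k 𝒮 ↔ SPIndep k 𝒮 (support z) := by
  simp [vertexSet]

/-- The vertex set is the set of characteristic vectors of the independent sets of `spMatroid`.
[cite: Rothvoss2013, §5 (p08)] -/
theorem coe_vertexSet_eq (hk : 1 ≤ k) (h𝒮 : 𝒮 ⊆ codeClass n k a) :
    ((vertexSet k 𝒮 : Finset (Fin n → Bool)) : Set (Fin n → Bool)) =
      {z | (spMatroid hk h𝒮).Indep {i | z i = true}} := by
  ext z
  have : ({i | z i = true} : Set (Fin n)) = (support z : Set (Fin n)) := by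
    ext i; simp [support]
  rw [mem_coe, mem_vertexSet, Set.mem_setOf_eq, this, spMatroid_indep_iff]

/-- Distinct subfamilies of `k`-sets give distinct vertex sets. [cite: Rothvoss2013, §5 (p08)] -/
theorem vertexSet_injOn (𝒰 : Finset (Finset (Fin n))) (h𝒰 : ∀ S ∈ 𝒰, S.card = k) :
    Set.InjOn (vertexSet k) {𝒮 | 𝒮 ⊆ 𝒰} := by
  intro 𝒮₁ h₁ 𝒮₂ h₂ heq
  simp only [Set.mem_setOf_eq] at h₁ h₂
  have key : ∀ S ∈ 𝒰, (S ∈ 𝒮₁ ↔ S ∈ 𝒮₂) := by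
    intro S hS
    have hz := Finset.ext_iff.1 heq (indicator S)
    rw [mem_vertexSet, mem_vertexSet, support_indicator] at hz
    simp only [SPIndep, h𝒰 S hS, lt_self_iff_false, true_and, false_or] at hz
    tauto
  ext S
  constructor
  · intro h; exact (key S (h₁ h)).1 h
  · intro h; exact (key S (h₂ h)).2 h

/-! ### M4. Counting -/

/-- **The count.** If, for a residue class `𝒰` of `⌊n/2⌋`-sets with `n·|𝒰| ≥ C(n,⌊n/2⌋)`, every
sparse paving matroid polytope `conv(χ(𝓘(𝒮)))`, `𝒮 ⊆ 𝒰`, has an extended formulation of size `r`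
(`2 ≤ n ≤ r ≤ 2ⁿ`), then `C(n, ⌊n/2⌋) ≤ 96 n² r²` — from `2^{|𝒰|}` distinct vertex sets against the
tree's `ZeroOneLpEF.card_le_of_forall_hasEFOfSize` (`≤ 2^{96 n r²}` members).
[cite: Rothvoss2013, Cor. 5 (§5, p08) with Thm. 4 (§4, p07)] -/
theorem choose_le_of_forall_hasEFOfSize (hn : 2 ≤ n) {r : ℕ} (hnr : n ≤ r) (hr2 : r ≤ 2 ^ n)
    (h𝒰 : n.choose (n / 2) ≤ n * (codeClass n (n / 2) a).card)
    (hall : ∀ 𝒮, 𝒮 ⊆ codeClass n (n / 2) a →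
      HasEFOfSize (convexHull ℝ (cubePoint '' ((vertexSet (n / 2) 𝒮 : Finset (Fin n → Bool)) :
        Set (Fin n → Bool)))) r) :
    n.choose (n / 2) ≤ 96 * n ^ 2 * r ^ 2 := by
  classical
  set 𝒰 := codeClass n (n / 2) a with h𝒰def
  set 𝓕 : Finset (Finset (Fin n → Bool)) := 𝒰.powerset.image (vertexSet (n / 2)) with h𝓕
  have hinj : Set.InjOn (vertexSet (n / 2)) (𝒰.powerset : Set (Finset (Finset (Fin n)))) := by
    have h := vertexSet_injOn 𝒰 (fun S hS => (mem_codeClass.1 hS).1)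
    intro x hx y hy hxy
    exact h (by simpa using hx) (by simpa using hy) hxy
  have hcard : 𝓕.card = 2 ^ 𝒰.card := by
    rw [h𝓕, card_image_of_injOn hinj, card_powerset]
  have hbound := ZeroOneLpEF.card_le_of_forall_hasEFOfSize (by omega) hnr hr2 𝓕 (by
    intro 𝒳 h𝒳
    rw [h𝓕, mem_image] at h𝒳
    obtain ⟨𝒮, h𝒮, rfl⟩ := h𝒳
    exact hall 𝒮 (mem_powerset.1 h𝒮))
  rw [hcard] at hbound
  have hU : 𝒰.card ≤ 96 * n * r ^ 2 := (Nat.pow_le_pow_iff_right (by norm_num)).1 hbound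
  calc n.choose (n / 2) ≤ n * 𝒰.card := h𝒰
    _ ≤ n * (96 * n * r ^ 2) := Nat.mul_le_mul_left _ hU
    _ = 96 * n ^ 2 * r ^ 2 := by ring

/-- `2ⁿ ≤ 2n · C(n, ⌊n/2⌋)` (`n ≥ 1`; Mathlib's `4^m ≤ 2m·C(2m,m)`). [folklore] -/
private theorem two_pow_le_mul_choose_half (hn : 1 ≤ n) : 2 ^ n ≤ 2 * n * n.choose (n / 2) := by
  obtain ⟨m, rfl | rfl⟩ := Nat.even_or_odd' n
  · have hm : 0 < m := by omega
    have h := Nat.four_pow_le_two_mul_self_mul_centralBinom m hm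
    rw [Nat.centralBinom_eq_two_mul_choose] at h
    rw [show 2 * m / 2 = m by omega, pow_mul, show (2 : ℕ) ^ 2 = 4 by norm_num]
    calc 4 ^ m ≤ 2 * m * (2 * m).choose m := h
      _ ≤ 2 * (2 * m) * (2 * m).choose m := by nlinarith [Nat.zero_le ((2 * m).choose m)]
  · rcases Nat.eq_zero_or_pos m with rfl | hm
    · simp
    have h := Nat.four_pow_le_two_mul_self_mul_centralBinom m hm
    rw [Nat.centralBinom_eq_two_mul_choose] at h
    have hmono : (2 * m).choose m ≤ (2 * m + 1).choose m := Nat.choose_le_choose m (by omega)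
    rw [show (2 * m + 1) / 2 = m by omega, pow_succ, pow_mul, show (2 : ℕ) ^ 2 = 4 by norm_num]
    calc 4 ^ m * 2 ≤ 2 * m * (2 * m).choose m * 2 := Nat.mul_le_mul_right _ h
      _ ≤ 2 * m * (2 * m + 1).choose m * 2 := by gcongr
      _ ≤ 2 * (2 * m + 1) * (2 * m + 1).choose m := by nlinarith [Nat.zero_le ((2 * m + 1).choose m)]

/-- `192 n⁵ < 2ⁿ` for `n ≥ 33`. [folklore] -/
private theorem mul_pow_five_lt_two_pow (hn : 33 ≤ n) : 192 * n ^ 5 < 2 ^ n := by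
  induction n, hn using Nat.le_induction with
  | base => norm_num
  | succ m hm ih =>
    have e5 : (m + 1) ^ 5 = m ^ 5 + 5 * m ^ 4 + 10 * m ^ 3 + 10 * m ^ 2 + 5 * m + 1 := by ring
    have h4 : 33 * m ^ 4 ≤ m ^ 5 := by rw [pow_succ, mul_comm]; exact Nat.mul_le_mul_left _ hm
    have h3 : m ^ 3 ≤ m ^ 4 := Nat.pow_le_pow_right (by omega) (by norm_num)
    have h2 : m ^ 2 ≤ m ^ 4 := Nat.pow_le_pow_right (by omega) (by norm_num)
    have h1 : m ≤ m ^ 4 := by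
      calc m = m ^ 1 := (pow_one m).symm
        _ ≤ m ^ 4 := Nat.pow_le_pow_right (by omega) (by norm_num)
    have h0 : 1 ≤ m ^ 4 := Nat.one_le_pow _ _ (by omega)
    have : (m + 1) ^ 5 ≤ 2 * m ^ 5 := by rw [e5]; nlinarith
    calc 192 * (m + 1) ^ 5 ≤ 192 * (2 * m ^ 5) := Nat.mul_le_mul_left _ this
      _ = 2 * (192 * m ^ 5) := by ring
      _ < 2 * 2 ^ m := by omega
      _ = 2 ^ (m + 1) := by rw [pow_succ]; ring

/-- **Existence.** For `n ≥ 33` some sparse paving matroid on `[n]` has NO small extended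
formulation of its polytope: every EF of `conv(χ(𝓘))` of size `k` has `C(n,⌊n/2⌋) ≤ 96 n² k²`
(printed: "`R := max{xc(conv(X))}` …", here a largest `R ≤ 2ⁿ` failing the count).
[cite: Rothvoss2013, Cor. 5 (§5, p08)] -/
theorem exists_matroid_choose_le (hn : 33 ≤ n) :
    ∃ (a : ℕ) (𝒮 : Finset (Finset (Fin n))) (_ : 𝒮 ⊆ codeClass n (n / 2) a),
      n.choose (n / 2) ≤ n * (codeClass n (n / 2) a).card ∧
      ∀ k : ℕ, HasEFOfSize (convexHull ℝ (cubePoint ''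
          ((vertexSet (n / 2) 𝒮 : Finset (Fin n → Bool)) : Set (Fin n → Bool)))) k →
        n.choose (n / 2) ≤ 96 * n ^ 2 * k ^ 2 := by
  classical
  obtain ⟨a, ha⟩ := exists_large_codeClass (show 1 ≤ n by omega) (n / 2)
  set P : ℕ → Prop := fun R => 96 * n ^ 2 * R ^ 2 < n.choose (n / 2) with hP
  have hlow : 192 * n ^ 5 < 2 * n * n.choose (n / 2) :=
    lt_of_lt_of_le (mul_pow_five_lt_two_pow hn) (two_pow_le_mul_choose_half (by omega))
  have hPn : P n := by
    show 96 * n ^ 2 * n ^ 2 < n.choose (n / 2)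
    have : 2 * n * (96 * n ^ 2 * n ^ 2) = 192 * n ^ 5 := by ring
    nlinarith
  set R₀ := Nat.findGreatest P (2 ^ n) with hR₀
  have hnR₀ : n ≤ R₀ := Nat.le_findGreatest (Nat.lt_two_pow_self).le hPn
  have hR₀2 : R₀ ≤ 2 ^ n := Nat.findGreatest_le _
  have hPR₀ : P R₀ := Nat.findGreatest_spec (P := P) (Nat.lt_two_pow_self).le hPn
  -- some `𝒮` has no EF of size `≤ R₀`
  have hex : ∃ 𝒮, 𝒮 ⊆ codeClass n (n / 2) a ∧ ∀ k ≤ R₀, ¬ HasEFOfSize (convexHull ℝ (cubePoint ''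
      ((vertexSet (n / 2) 𝒮 : Finset (Fin n → Bool)) : Set (Fin n → Bool)))) k := by
    by_contra hcon
    push Not at hcon
    have hall : ∀ 𝒮, 𝒮 ⊆ codeClass n (n / 2) a → HasEFOfSize (convexHull ℝ (cubePoint ''
        ((vertexSet (n / 2) 𝒮 : Finset (Fin n → Bool)) : Set (Fin n → Bool)))) R₀ := by
      intro 𝒮 h𝒮
      obtain ⟨k, hk, h⟩ := hcon 𝒮 h𝒮
      exact h.of_le hk
    have := choose_le_of_forall_hasEFOfSize (by omega) hnR₀ hR₀2 ha hall
    exact absurd this (not_le.2 hPR₀)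
  obtain ⟨𝒮, h𝒮, hnot⟩ := hex
  refine ⟨a, 𝒮, h𝒮, ha, fun k hk => ?_⟩
  have hkR : R₀ < k := by
    by_contra hle
    exact hnot k (not_lt.1 hle) hk
  by_cases hk2 : k ≤ 2 ^ n
  · exact not_lt.1 (Nat.findGreatest_is_greatest (P := P) hkR hk2)
  · have hk1 : 2 ^ n ≤ k := by omega
    have h2 : n.choose (n / 2) ≤ 2 ^ n := (Nat.choose_le_two_pow _ _)  -- hmm name
    calc n.choose (n / 2) ≤ 2 ^ n := h2
      _ ≤ k := hk1
      _ ≤ k ^ 2 := by nlinarith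
      _ = 1 * 1 * k ^ 2 := by ring
      _ ≤ 96 * n ^ 2 * k ^ 2 := by gcongr <;> nlinarith

/-! ### M5. `C(n, ⌊n/2⌋) ≥ 2ⁿ/√(8n)` and the printed form -/

/-- `16^m ≤ 4m · C(2m,m)²` (`m ≥ 1`): the elementary half of Wallis, by induction using
`(m+1)·C(2m+2,m+1) = 2(2m+1)·C(2m,m)` and `4m(m+1) ≤ (2m+1)²`. [folklore] -/
private theorem sixteen_pow_le {m : ℕ} (hm : 1 ≤ m) : 16 ^ m ≤ 4 * m * m.centralBinom ^ 2 := by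
  induction m, hm using Nat.le_induction with
  | base => simp [Nat.centralBinom, Nat.choose]
  | succ m hm ih =>
    have hrec := Nat.succ_mul_centralBinom_succ m
    -- multiply the goal by `m + 1`
    have key : (m + 1) * 16 ^ (m + 1) ≤ (m + 1) * (4 * (m + 1) * (m + 1).centralBinom ^ 2) := by
      have h1 : (m + 1) * (4 * (m + 1) * (m + 1).centralBinom ^ 2)
          = 4 * ((m + 1) * (m + 1).centralBinom) ^ 2 := by ring
      rw [h1, hrec]
      have h2 : 4 * (2 * (2 * m + 1) * m.centralBinom) ^ 2
          = 16 * (2 * m + 1) ^ 2 * m.centralBinom ^ 2 := by ring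
      rw [h2]
      have h3 : (m + 1) * 16 ^ (m + 1) = 16 * ((m + 1) * 16 ^ m) := by ring
      rw [h3]
      have h4 : (m + 1) * 16 ^ m ≤ (m + 1) * (4 * m * m.centralBinom ^ 2) := Nat.mul_le_mul_left _ ih
      have h5 : (m + 1) * (4 * m * m.centralBinom ^ 2) ≤ (2 * m + 1) ^ 2 * m.centralBinom ^ 2 := by
        have : (m + 1) * (4 * m) ≤ (2 * m + 1) ^ 2 := by nlinarith
        calc (m + 1) * (4 * m * m.centralBinom ^ 2) = ((m + 1) * (4 * m)) * m.centralBinom ^ 2 := by ring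
          _ ≤ (2 * m + 1) ^ 2 * m.centralBinom ^ 2 := Nat.mul_le_mul_right _ this
      calc 16 * ((m + 1) * 16 ^ m) ≤ 16 * ((m + 1) * (4 * m * m.centralBinom ^ 2)) :=
            Nat.mul_le_mul_left _ h4
        _ ≤ 16 * ((2 * m + 1) ^ 2 * m.centralBinom ^ 2) := Nat.mul_le_mul_left _ h5
        _ = 16 * (2 * m + 1) ^ 2 * m.centralBinom ^ 2 := by ring
    exact Nat.le_of_mul_le_mul_left key (by omega)

/-- `4ⁿ ≤ 8n · C(n, ⌊n/2⌋)²` (`n ≥ 2`). [folklore] -/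
private theorem four_pow_le_mul_choose_half_sq (hn : 2 ≤ n) :
    4 ^ n ≤ 8 * n * n.choose (n / 2) ^ 2 := by
  obtain ⟨m, rfl | rfl⟩ := Nat.even_or_odd' n
  · have hm : 1 ≤ m := by omega
    have h := sixteen_pow_le hm
    rw [Nat.centralBinom_eq_two_mul_choose] at h
    rw [show 2 * m / 2 = m by omega, pow_mul, show (4 : ℕ) ^ 2 = 16 by norm_num]
    calc 16 ^ m ≤ 4 * m * ((2 * m).choose m) ^ 2 := h
      _ ≤ 8 * (2 * m) * ((2 * m).choose m) ^ 2 := by nlinarith [Nat.zero_le (((2 * m).choose m) ^ 2)]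
  · have hm : 1 ≤ m := by omega
    have h := sixteen_pow_le hm
    rw [Nat.centralBinom_eq_two_mul_choose] at h
    have hmono : (2 * m).choose m ≤ (2 * m + 1).choose m := Nat.choose_le_choose m (by omega)
    have hmono2 : ((2 * m).choose m) ^ 2 ≤ ((2 * m + 1).choose m) ^ 2 := Nat.pow_le_pow_left hmono 2
    rw [show (2 * m + 1) / 2 = m by omega, pow_succ, pow_mul, show (4 : ℕ) ^ 2 = 16 by norm_num]
    calc 16 ^ m * 4 ≤ 4 * m * ((2 * m).choose m) ^ 2 * 4 := Nat.mul_le_mul_right _ h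
      _ ≤ 4 * m * ((2 * m + 1).choose m) ^ 2 * 4 := by gcongr
      _ ≤ 8 * (2 * m + 1) * ((2 * m + 1).choose m) ^ 2 := by
          nlinarith [Nat.zero_le (((2 * m + 1).choose m) ^ 2)]

end SparsePavingXC

open SparsePavingXC Literature.Barriers.PneNP in
/-- **Rothvoß 2013, Corollary 5** (Math. Program. 142 (2013) = arXiv:1105.0036, §5 p08, verbatim):
"There exists a family `M_n = ({1,…,n}, 𝓘_n)` of matroids such that
`xc(conv(χ(𝓘_n))) = Ω(2^{n/2} / (n^{5/4} log(2n)))`."  Here matroids are Mathlib's `Matroid (Fin n)`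
(axioms (I)–(II) of p08), `χ(𝓘)` the 0/1 characteristic vectors of the independent sets (the
tree's `cubePoint`), `xc` the least size of an extended formulation (§3 p05) in the consumed
slack-form reading `Literature.Barriers.PneNP.HasEFOfSize`, and `Ω` read as
`∃ c > 0 ∃ n₀ ∀ n ≥ n₀` (here `c = 1/17`, `n₀ = 33`; the matroids are sparse paving). PROVED from
`SparsePavingXC.exists_matroid_choose_le` and `C(n,⌊n/2⌋) ≥ 2ⁿ/√(8n)`.
[cite: Rothvoss2013, Cor. 5 (§5, p08)] -/
theorem Rothvoss2013_cor5 :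
    ∃ c : ℝ, 0 < c ∧ ∃ n₀ : ℕ, ∀ n : ℕ, n₀ ≤ n → ∃ M : Matroid (Fin n),
      ∀ k : ℕ, HasEFOfSize (convexHull ℝ
          (cubePoint '' {z : Fin n → Bool | M.Indep {i | z i = true}})) k →
        c * (2 : ℝ) ^ ((n : ℝ) / 2) / ((n : ℝ) ^ (5 / 4 : ℝ) * Real.log (2 * n)) ≤ k := by
  refine ⟨1 / 17, by norm_num, 33, fun n hn => ?_⟩
  obtain ⟨a, 𝒮, h𝒮, -, hk⟩ := exists_matroid_choose_le hn
  have hhalf : 1 ≤ n / 2 := by omega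
  refine ⟨spMatroid hhalf h𝒮, fun k hkEF => ?_⟩
  rw [← coe_vertexSet_eq hhalf h𝒮] at hkEF
  have hnat := hk k hkEF
  have h4 := SparsePavingXC.four_pow_le_mul_choose_half_sq (show 2 ≤ n by omega)
  -- real arithmetic
  have hn0 : (0 : ℝ) < n := by exact_mod_cast (show 0 < n by omega)
  have hn1 : (1 : ℝ) ≤ n := by exact_mod_cast (show 1 ≤ n by omega)
  have hk0 : (0 : ℝ) ≤ k := Nat.cast_nonneg k
  have hC : ((n.choose (n / 2) : ℕ) : ℝ) ≤ 96 * (n : ℝ) ^ 2 * (k : ℝ) ^ 2 := by exact_mod_cast hnat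
  have h4r : (4 : ℝ) ^ n ≤ 8 * n * ((n.choose (n / 2) : ℕ) : ℝ) ^ 2 := by exact_mod_cast h4
  -- `k⁴ ≥ 4ⁿ / (8 n · 96² n⁴)`
  have hk4 : (4 : ℝ) ^ n ≤ 73728 * (n : ℝ) ^ 5 * (k : ℝ) ^ 4 := by
    have hC0 : (0 : ℝ) ≤ ((n.choose (n / 2) : ℕ) : ℝ) := Nat.cast_nonneg _
    calc (4 : ℝ) ^ n ≤ 8 * n * ((n.choose (n / 2) : ℕ) : ℝ) ^ 2 := h4r
      _ ≤ 8 * n * (96 * (n : ℝ) ^ 2 * (k : ℝ) ^ 2) ^ 2 := by gcongr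
      _ = 73728 * (n : ℝ) ^ 5 * (k : ℝ) ^ 4 := by ring
  have hn33 : (33 : ℝ) ≤ n := by exact_mod_cast hn
  have hlog : 1 ≤ Real.log (2 * n) := by
    have h3 : (3 : ℝ) ≤ 2 * n := by linarith
    rw [Real.le_log_iff_exp_le (by linarith)]
    exact (Real.exp_one_lt_d9.le.trans (by norm_num)).trans h3
  have hnpow : (1 : ℝ) ≤ (n : ℝ) ^ (5 / 4 : ℝ) := Real.one_le_rpow hn1 (by norm_num)
  -- drop the logarithm
  set A : ℝ := 1 / 17 * (2 : ℝ) ^ ((n : ℝ) / 2) / (n : ℝ) ^ (5 / 4 : ℝ) with hA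
  have hA0 : 0 ≤ A := by positivity
  have hle1 : 1 / 17 * (2 : ℝ) ^ ((n : ℝ) / 2) / ((n : ℝ) ^ (5 / 4 : ℝ) * Real.log (2 * n)) ≤ A := by
    rw [hA, div_le_div_iff_of_pos_left (by positivity) (by positivity) (by positivity)]
    calc (n : ℝ) ^ (5 / 4 : ℝ) = (n : ℝ) ^ (5 / 4 : ℝ) * 1 := (mul_one _).symm
      _ ≤ (n : ℝ) ^ (5 / 4 : ℝ) * Real.log (2 * n) := by gcongr
  refine hle1.trans ?_
  -- compare fourth powers
  rw [← pow_le_pow_iff_left₀ hA0 hk0 (by norm_num : (4 : ℕ) ≠ 0)]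
  have h2 : ((2 : ℝ) ^ ((n : ℝ) / 2)) ^ 4 = (4 : ℝ) ^ n := by
    rw [← Real.rpow_natCast ((2 : ℝ) ^ ((n : ℝ) / 2)) 4, ← Real.rpow_mul (by norm_num)]
    rw [show (n : ℝ) / 2 * (4 : ℕ) = ((2 * n : ℕ) : ℝ) by push_cast; ring, Real.rpow_natCast,
      pow_mul]
    norm_num
  have h5 : ((n : ℝ) ^ (5 / 4 : ℝ)) ^ 4 = (n : ℝ) ^ 5 := by
    rw [← Real.rpow_natCast ((n : ℝ) ^ (5 / 4 : ℝ)) 4, ← Real.rpow_mul hn0.le]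
    rw [show (5 / 4 : ℝ) * (4 : ℕ) = ((5 : ℕ) : ℝ) by norm_num, Real.rpow_natCast]
  have hA4 : A ^ 4 = (1 / 17) ^ 4 * (4 : ℝ) ^ n / (n : ℝ) ^ 5 := by
    rw [hA, div_pow, mul_pow, h2, h5]
  rw [hA4, div_le_iff₀ (by positivity)]
  have h4pos : (0 : ℝ) < (4 : ℝ) ^ n := pow_pos (by norm_num) n
  linarith [hk4, h4pos]

/-! ### M6. Doubly-exponentially many matroids -/

namespace SparsePavingXC

variable {n k a : ℕ}

/-- Distinct subfamilies of one residue class give distinct sparse paving matroids (their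
independent `k`-sets differ). [cite: Rothvoss2013, §5 (p08)] -/
theorem spMatroid_injective (hk : 1 ≤ k) {𝒮₁ 𝒮₂ : Finset (Finset (Fin n))}
    (h₁ : 𝒮₁ ⊆ codeClass n k a) (h₂ : 𝒮₂ ⊆ codeClass n k a)
    (h : spMatroid hk h₁ = spMatroid hk h₂) : 𝒮₁ = 𝒮₂ := by
  refine vertexSet_injOn (codeClass n k a) (fun S hS => (mem_codeClass.1 hS).1) h₁ h₂ ?_
  apply Finset.coe_injective
  rw [coe_vertexSet_eq hk h₁, coe_vertexSet_eq hk h₂, h]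

/-- **Doubly-exponentially many matroids** (printed: "it is well known that the number of matroids
with ground set `{1,…,n}` is at least `2^{C(n,⌊n/2⌋)/(2n)}` … In other words, there are
doubly-exponentially many matroids"): for every `n ≥ 2` there is a family `𝒰` of `⌊n/2⌋`-subsets
of `[n]` with `n·|𝒰| ≥ C(n,⌊n/2⌋)` and an injection of its `2^{|𝒰|}` subfamilies into the matroids
on `[n]` (the sparse paving matroids `spMatroid`). [cite: Rothvoss2013, §5 (p08)] -/
theorem exists_injOn_matroid_family (hn : 2 ≤ n) :
    ∃ (𝒰 : Finset (Finset (Fin n))) (F : Finset (Finset (Fin n)) → Matroid (Fin n)),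
      n.choose (n / 2) ≤ n * 𝒰.card ∧ (∀ S ∈ 𝒰, S.card = n / 2) ∧
      Set.InjOn F (𝒰.powerset : Set (Finset (Finset (Fin n)))) := by
  classical
  obtain ⟨a, ha⟩ := exists_large_codeClass (show 1 ≤ n by omega) (n / 2)
  have hk : 1 ≤ n / 2 := by omega
  refine ⟨codeClass n (n / 2) a, fun 𝒮 => if h : 𝒮 ⊆ codeClass n (n / 2) a then spMatroid hk h
      else spMatroid hk (empty_subset (codeClass n (n / 2) a)), ha,
    fun S hS => (mem_codeClass.1 hS).1, ?_⟩
  intro 𝒮₁ h₁ 𝒮₂ h₂ heq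
  have h₁' : 𝒮₁ ⊆ codeClass n (n / 2) a := by simpa using h₁
  have h₂' : 𝒮₂ ⊆ codeClass n (n / 2) a := by simpa using h₂
  simp only [dif_pos h₁', dif_pos h₂'] at heq
  exact spMatroid_injective hk h₁' h₂' heq

end SparsePavingXC

end Literature.Combinatorics.Optimization

end
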